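import Summits.CriticalPhenomena.PercolationContinuityZ3.Theorems.PercNearOneGluingNoHeavyLowerTailSahiGridPatternAllDim

/-!
# `NoHeavyLowerTail` (crux stmt-CriticalPhenomena-4575), Sahi programme P1: the pattern tensor and its SLICES as INDICATOR FORMULAS,
# every dimension

Support file (Sahi cell, seat `prim-sahi-p1`, generation 8; `--supports stmt-CriticalPhenomena-4575`).  Pure proofs; the only definitions
are the bookkeeping ones `TotDist` (two points of `[3]^d` differ in EVERY axis), `thirdPt` (the third point of the Latin line through two
such points), `nuCount` and `thetaVal`; no `sorry`, standard axioms.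

THE MATHEMATICS.  With `t_d` the pattern tensor of `…SahiGridPatternAllDim` (`tcD`):
* `tcD_eq_ite`: `t_d(p,q,r) = 2^{d+1}[p=q=r] − [q=r, p δ̸ q] − [p=r, q δ̸ p] − [p=q, r δ̸ p] + [q δ̸ r, p = q̄r]`, where `x δ̸ y`
  (`TotDist x y`) means `x_a ≠ y_a` for every axis `a` and `q̄r = thirdPt q r` is the point with `{q_a, r_a, (q̄r)_a} = {0,1,2}` in every axis.
* `sliceForm_eq` (**the slice form**): for every `A ⊆ [3]^d`,
  `β_A(q,r) := Σ_{p∈A} t_d(p,q,r) = [q = r]·(2^{d+1}·1_A(q) − ν_A(q)) − [q δ̸ r]·(1_A(q) + 1_A(r) − 1_A(q̄r))`,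
  `ν_A(q) = #{p ∈ A : p δ̸ q}` (`nuCount`), and the off-diagonal part is `Θ_A(q,r)` (`thetaVal`).  Consequently the pattern functional is
  `S_d(A,B,C) = 2^{d+1}|A∩B∩C| − N(A, B∩C) − N(A∩B, C) − N(B, A∩C) + M(A,B,C)` in the counting form of generation 6 (there for `d = 3`).
These are the objects of the slice recursion / "Θ-positivity" / "z-conditioning" observations of the generation-8 memo
(HOME/FROM-prim-sahi-p1-gen8-PATTERNPOS4-SLICES.md §3); nothing conjectural is asserted here. [this work]
-/

namespace Summit.CriticalPhenomena.PercolationContinuityZ3.Theorems.SahiGridPattern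

open Finset SahiGrid3
open scoped BigOperators

variable {d : ℕ}

/-! ### Total distinctness and the third point -/

/-- `TotDist p q` (Boolean): the points `p, q ∈ [3]^d` differ in every axis. [this work] -/
def TotDist (p q : Pd d) : Bool := decide (∀ a, p a ≠ q a)

/-- Unfolding `TotDist`. [this work] -/
theorem totDist_iff {p q : Pd d} : TotDist p q = true ↔ ∀ a, p a ≠ q a := by
  unfold TotDist; rw [decide_eq_true_iff]

/-- The third point of the Latin line through `q, r`: in every axis the value `−(q_a + r_a) (mod 3)`, i.e. the element of `{0,1,2}`
other than `q_a ≠ r_a`. [this work] -/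
def thirdPt (q r : Pd d) : Pd d := fun a => -(q a + r a)

/-- Per-axis fact: three values of `Fin 3` are pairwise distinct iff the last two differ and the first is minus their sum. [this work] -/
theorem fin3_distinct_iff (u v w : Fin 3) : (u ≠ v ∧ v ≠ w ∧ u ≠ w) ↔ (v ≠ w ∧ u = -(v + w)) := by
  revert u v w; decide

/-- `TotDist` is symmetric. [this work] -/
theorem totDist_comm {p q : Pd d} : TotDist p q = true ↔ TotDist q p = true := by
  rw [totDist_iff, totDist_iff]; exact ⟨fun h a => (h a).symm, fun h a => (h a).symm⟩

/-! ### The per-axis products as indicators -/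

/-- `∏_a c1 = 2^d · [p = q = r]`. [this work] -/
theorem prod_c1_eq (p q r : Pd d) : (∏ a, c1 (p a) (q a) (r a)) = if (p = q ∧ q = r) then (2 : ℤ) ^ d else 0 := by
  unfold c1
  rw [Finset.prod_ite_zero, Finset.prod_const, Finset.card_univ, Fintype.card_fin]
  by_cases h : p = q ∧ q = r
  · rw [if_pos h, if_pos]; intro a _; exact ⟨congrFun h.1 a, congrFun h.2 a⟩
  · rw [if_neg h, if_neg]; intro h'
    exact h ⟨funext fun a => (h' a (mem_univ a)).1, funext fun a => (h' a (mem_univ a)).2⟩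

/-- `∏_a c2(p,q,r) = [p δ̸ q ∧ q = r]`. [this work] -/
theorem prod_c2_eq (p q r : Pd d) : (∏ a, c2 (p a) (q a) (r a)) = if (TotDist p q = true ∧ q = r) then (1 : ℤ) else 0 := by
  unfold c2
  rw [Finset.prod_ite_zero, Finset.prod_const_one]
  by_cases h : TotDist p q = true ∧ q = r
  · rw [if_pos h, if_pos]; intro a _; exact ⟨(totDist_iff.1 h.1) a, congrFun h.2 a⟩
  · rw [if_neg h, if_neg]; intro h'
    exact h ⟨totDist_iff.2 fun a => (h' a (mem_univ a)).1, funext fun a => (h' a (mem_univ a)).2⟩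

/-- `∏_a c3(p,q,r) = [q δ̸ r ∧ p = thirdPt q r]`. [this work] -/
theorem prod_c3_eq (p q r : Pd d) : (∏ a, c3 (p a) (q a) (r a)) = if (TotDist q r = true ∧ p = thirdPt q r) then (1 : ℤ) else 0 := by
  unfold c3
  rw [Finset.prod_ite_zero, Finset.prod_const_one]
  by_cases h : TotDist q r = true ∧ p = thirdPt q r
  · rw [if_pos h, if_pos]; intro a _
    exact (fin3_distinct_iff (p a) (q a) (r a)).2 ⟨(totDist_iff.1 h.1) a, by rw [h.2]; rfl⟩
  · rw [if_neg h, if_neg]; intro h'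
    refine h ⟨totDist_iff.2 fun a => ((fin3_distinct_iff (p a) (q a) (r a)).1 (h' a (mem_univ a))).1, funext fun a => ?_⟩
    exact ((fin3_distinct_iff (p a) (q a) (r a)).1 (h' a (mem_univ a))).2

/-- **The pattern tensor as indicators** (every dimension). [this work] -/
theorem tcD_eq_ite (p q r : Pd d) : tcD p q r =
    2 * (if (p = q ∧ q = r) then (2 : ℤ) ^ d else 0) - (if (TotDist p q = true ∧ q = r) then 1 else 0)
      - (if (TotDist q p = true ∧ p = r) then 1 else 0) - (if (TotDist r p = true ∧ p = q) then 1 else 0)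
      + (if (TotDist q r = true ∧ p = thirdPt q r) then 1 else 0) := by
  unfold tcD
  rw [prod_c1_eq, prod_c2_eq, prod_c2_eq, prod_c2_eq, prod_c3_eq]

/-! ### The slice form -/

/-- `ν_A(q) = #{p ∈ A : p δ̸ q}`. [this work] -/
def nuCount (A : Finset (Pd d)) (q : Pd d) : ℕ := (A.filter fun p => TotDist p q = true).card

/-- `Θ_A(q,r) = [q δ̸ r]·(1_A(q) + 1_A(r) − 1_A(q̄r))`. [this work] -/
def thetaVal (A : Finset (Pd d)) (q r : Pd d) : ℤ :=
  if TotDist q r = true then ind A q + ind A r - ind A (thirdPt q r) else 0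

/-- Diagonal term: `Σ_{p∈A} [p = q ∧ q = r]·c = [q = r]·c·1_A(q)`. [this work] -/
theorem sum_ite_eq_eq (A : Finset (Pd d)) (q r : Pd d) (c : ℤ) :
    (∑ p ∈ A, if (p = q ∧ q = r) then c else 0) = if q = r then c * ind A q else 0 := by
  by_cases hqr : q = r
  · simp only [hqr, and_true, if_true]
    rw [Finset.sum_ite_eq' A r (fun _ => c)]
    unfold ind; split_ifs <;> simp
  · rw [if_neg hqr]
    exact Finset.sum_eq_zero fun p _ => by rw [if_neg]; exact fun h => hqr h.2

/-- The `ν`-term: `Σ_{p∈A} [p δ̸ q ∧ q = r] = [q = r]·ν_A(q)`. [this work] -/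
theorem sum_ite_totDist_eq (A : Finset (Pd d)) (q r : Pd d) :
    (∑ p ∈ A, if (TotDist p q = true ∧ q = r) then (1:ℤ) else 0) = if q = r then (nuCount A q : ℤ) else 0 := by
  by_cases hqr : q = r
  · simp only [hqr, and_true, if_true]
    rw [Finset.sum_boole]
    unfold nuCount
    subst hqr; rfl
  · rw [if_neg hqr]
    exact Finset.sum_eq_zero fun p _ => by rw [if_neg]; exact fun h => hqr h.2

/-- A point term: `Σ_{p∈A} [P ∧ p = x] = [P]·1_A(x)`. [this work] -/
theorem sum_ite_and_eq (A : Finset (Pd d)) (x : Pd d) (P : Prop) [Decidable P] :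
    (∑ p ∈ A, if (P ∧ p = x) then (1:ℤ) else 0) = if P then ind A x else 0 := by
  by_cases hP : P
  · simp only [hP, true_and, if_true]
    rw [Finset.sum_ite_eq' A x (fun _ => (1:ℤ))]
    unfold ind; rfl
  · rw [if_neg hP]
    exact Finset.sum_eq_zero fun p _ => by rw [if_neg]; exact fun h => hP h.1

/-- **The slice form**: `Σ_{p∈A} t_d(p,q,r) = [q = r]·(2^{d+1}·1_A(q) − ν_A(q)) − Θ_A(q,r)`. [this work] -/
theorem sliceForm_eq (A : Finset (Pd d)) (q r : Pd d) :
    (∑ p ∈ A, tcD p q r) =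
      (if q = r then 2 * (2 : ℤ) ^ d * ind A q - (nuCount A q : ℤ) else 0) - thetaVal A q r := by
  simp only [tcD_eq_ite, Finset.sum_add_distrib, Finset.sum_sub_distrib]
  have h1 : (∑ p ∈ A, 2 * (if (p = q ∧ q = r) then (2:ℤ) ^ d else 0)) = if q = r then 2 * 2 ^ d * ind A q else 0 := by
    rw [← Finset.mul_sum, sum_ite_eq_eq]; split_ifs <;> ring
  have h2 := sum_ite_totDist_eq A q r
  have h3 : (∑ p ∈ A, if (TotDist q p = true ∧ p = r) then (1:ℤ) else 0) = if TotDist q r = true then ind A r else 0 := by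
    have : ∀ p ∈ A, (if (TotDist q p = true ∧ p = r) then (1:ℤ) else 0) = if (TotDist q r = true ∧ p = r) then 1 else 0 := by
      intro p _
      by_cases hp : p = r
      · subst hp; rfl
      · rw [if_neg (fun h => hp h.2), if_neg (fun h => hp h.2)]
    rw [Finset.sum_congr rfl this, sum_ite_and_eq]
  have h4 : (∑ p ∈ A, if (TotDist r p = true ∧ p = q) then (1:ℤ) else 0) = if TotDist q r = true then ind A q else 0 := by
    have : ∀ p ∈ A, (if (TotDist r p = true ∧ p = q) then (1:ℤ) else 0) = if (TotDist q r = true ∧ p = q) then 1 else 0 := by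
      intro p _
      by_cases hp : p = q
      · subst hp
        by_cases ht : TotDist r p = true
        · rw [if_pos ⟨ht, rfl⟩, if_pos ⟨totDist_comm.1 ht, rfl⟩]
        · rw [if_neg (fun h => ht h.1), if_neg (fun h => ht (totDist_comm.1 h.1))]
      · rw [if_neg (fun h => hp h.2), if_neg (fun h => hp h.2)]
    rw [Finset.sum_congr rfl this, sum_ite_and_eq]
  have h5 : (∑ p ∈ A, if (TotDist q r = true ∧ p = thirdPt q r) then (1:ℤ) else 0) = if TotDist q r = true then ind A (thirdPt q r) else 0 :=
    sum_ite_and_eq A (thirdPt q r) (TotDist q r = true)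
  rw [h1, h2, h3, h4, h5]
  unfold thetaVal
  split_ifs <;> ring

end Summit.CriticalPhenomena.PercolationContinuityZ3.Theorems.SahiGridPattern
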